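import Literature.NumberTheory.Transcendental.PkappaThetaAdditionPoly
import Literature.NumberTheory.Transcendental.PkappaThetaBlockRelations
import HarnessLib

/-!
# `Θ`-morphic maps between the theta models of the groups `M_κ`

Topic: `Literature/NumberTheory/Transcendental`. A brick of the discharge of the named fact
`Literature.NumberTheory.Transcendental.philippon1986_std` (Philippon's zero estimate, Bull. SMF 114
(1986), Thm. 2.1, for `M_κ = 𝔾ₘ^β × P_κ` in the theta embedding `GaGmE.Std.theta` of
`PkappaTheta.lean`), more precisely of the classification of the obstruction subgroups of D. Roy's
form of the zero estimate (LNM 1752, Ch. 11, Thm. 4.1; tree: `AnalyticGroupModel.zero_estimate`):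
one has to know that the preimage `Lie G' + ker(exp)` of a connected algebraic subgroup `G'`
(`GaGmE.Std.preimageSubgroup`) is CUT OUT by forms in the theta functions. For a general abelian
datum `C ≤ ℚ^γ` this is reduced to the split case `C = span{e_b}` by transporting forms along
isomorphisms `M_κ ≅ M_{κ'}` (integer changes of the `E`-coordinates). This file sets up the
transport:

* `GaGmE.Std.IsThetaMorphic L κ κ' Φ` — a map `Φ : Lie M_κ → Lie M_{κ'}` is **`Θ`-morphic** when
  locally on the source it is given by forms: for every `w₀` there are a degree `d`, forms
  `A_J ∈ ℂ[X]_d` and an entire "unit" `u` with `u(w₀) ≠ 0` and `A_J(Θ_κ(w)) = u(w) Θ_{κ',J}(Φ w)`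
  for all `w` (Roy's "morphisms given by a complete system of polynomial representations",
  op. cit. §2.1);
* `IsThetaMorphic.id`, `IsThetaMorphic.comp` — identities and composites (substitution of forms);
* `GaGmE.Std.ThetaDefinable L κ X` — `X` is the common zero set of a set of forms (through
  `GaGmE.Std.thetaEval`), and **`ThetaDefinable.preimage`**: preimages of definable sets under
  `Θ`-morphic maps are definable;
* instances: **translations** `w ↦ w + u` (`isThetaMorphic_add_const`, by the composed addition
  law `lawPoly` of `PkappaThetaAdditionPoly.lean` and its completeness `exists_lawUnit_ne_zero`),
  and the **sign change of one `E`-coordinate** `z'_b ↦ -z'_b`, which is an isomorphism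
  `M_κ ≅ M_{κ'}` onto the model with `κ'_{·b} = -κ_{·b}` (`isThetaMorphic_flip`; by the parity of
  the blocks: `P(-z) = (-P₀, -P₁, P₂)`, `Z(-z) = (Z₀, Z₁, -Z₂)`, `univExtP_neg`, `univExtZ_neg`).

Everything is PROVED; the only definitions are the two predicates, the sign `blockSign`, the
flipped `κ` and the flip map.

## References

* Yu. V. Nesterenko, P. Philippon (eds.), *Introduction to Algebraic Independence Theory*,
  LNM 1752, Springer 2001, Ch. 11 (D. Roy), §2.1, Thm. 4.1. [NesterenkoPhilippon2001]
* D. Bertrand, P. Philippon, *Sous-groupes algébriques de groupes algébriques commutatifs*,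
  Illinois J. Math. 32 (1988), 263–280. [folklore]
-/

noncomputable section

open Complex MvPolynomial
open scoped PeriodPair

namespace Literature.NumberTheory.Transcendental

/-! ### Parity of the blocks -/

/-- The sign `ε_i` with `P_i(-z) = ε_i P_i(z)`: `ε = (-1, -1, 1)`. [folklore] -/
def blockSign (i : Fin 3) : ℂ := if i = 2 then 1 else -1

/-- `ε_i² = 1`. [folklore] -/
theorem blockSign_mul_self (i : Fin 3) : blockSign i * blockSign i = 1 := by
  unfold blockSign; split_ifs <;> norm_num

/-- `ε_i ≠ 0`. [folklore] -/
theorem blockSign_ne_zero (i : Fin 3) : blockSign i ≠ 0 := by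
  unfold blockSign; split_ifs <;> norm_num

variable (L : PeriodPair)

/-- **Parity of the blocks**: `P_i(-z) = ε_i P_i(z)` (`σ³` odd, `℘` even, `℘′` odd). [folklore] -/
theorem _root_.PeriodPair.univExtP_neg (i : Fin 3) (z : ℂ) :
    L.univExtP i (-z) = blockSign i * L.univExtP i z := by
  have hc : Continuous (L.univExtP i) := (L.differentiable_univExtP i).continuous
  have key : (fun z => L.univExtP i (-z)) = fun z => blockSign i * L.univExtP i z := by
    refine L.eq_of_eqOn_compl_lattice (hc.comp continuous_neg) (continuous_const.mul hc) fun w hw => ?_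
    have hw' : -w ∉ L.lattice := fun h => hw (by simpa using L.lattice.neg_mem h)
    obtain ⟨p0, p1, p2⟩ := PeriodPair.univExtP_eq (L := L) hw
    obtain ⟨q0, q1, q2⟩ := PeriodPair.univExtP_eq (L := L) hw'
    show L.univExtP i (-w) = blockSign i * L.univExtP i w
    obtain rfl | rfl | rfl : i = 0 ∨ i = 1 ∨ i = 2 := by fin_cases i <;> simp
    · rw [q0, p0, L.weierstrassSigma_neg]; simp [blockSign]; ring
    · rw [q1, p1, L.weierstrassSigma_neg, L.weierstrassP_neg]; simp [blockSign]; ring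
    · rw [q2, p2, L.weierstrassSigma_neg, L.derivWeierstrassP_neg]; simp [blockSign]; ring
  exact congr_fun key z

/-- **Parity of the companions**: `Z_i(-z) = -ε_i Z_i(z)` (`ζ` odd). [folklore] -/
theorem _root_.PeriodPair.univExtZ_neg (i : Fin 3) (z : ℂ) :
    L.univExtZ i (-z) = -(blockSign i * L.univExtZ i z) := by
  have hc : Continuous (L.univExtZ i) := (L.differentiable_univExtZ i).continuous
  have key : (fun z => L.univExtZ i (-z)) = fun z => -(blockSign i * L.univExtZ i z) := by
    refine L.eq_of_eqOn_compl_lattice (hc.comp continuous_neg) (continuous_const.mul hc).neg fun w hw => ?_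
    have hw' : -w ∉ L.lattice := fun h => hw (by simpa using L.lattice.neg_mem h)
    obtain ⟨p0, p1, p2⟩ := PeriodPair.univExtZ_eq (L := L) hw
    obtain ⟨q0, q1, q2⟩ := PeriodPair.univExtZ_eq (L := L) hw'
    show L.univExtZ i (-w) = -(blockSign i * L.univExtZ i w)
    obtain rfl | rfl | rfl : i = 0 ∨ i = 1 ∨ i = 2 := by fin_cases i <;> simp
    · rw [q0, p0, L.weierstrassSigma_neg, L.weierstrassZeta_neg]; simp [blockSign]; ring
    · rw [q1, p1, L.weierstrassSigma_neg, L.weierstrassZeta_neg, L.weierstrassP_neg]; simp [blockSign]; ring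
    · rw [q2, p2, L.weierstrassSigma_neg, L.weierstrassZeta_neg, L.weierstrassP_neg,
        L.derivWeierstrassP_neg]
      simp [blockSign]; ring
  exact congr_fun key z

namespace GaGmE

namespace Std

variable {β γ δ : Type} [Fintype β] [Fintype γ] [Fintype δ] [DecidableEq γ]
variable (κM κM' κM'' : δ → γ → Kbar)

/-! ### `Θ`-morphic maps -/

/-- **`Θ`-morphic maps** `Φ : Lie M_κ → Lie M_{κ'}`: locally on the source, `Θ_{κ'} ∘ Φ` is given by
forms in `Θ_κ` up to a unit — for every `w₀` there are `d`, forms `A_J` of degree `d` and a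
function `u` with `u(w₀) ≠ 0` and `A_J(Θ_κ(w)) = u(w) · Θ_{κ',J}(Φ(w))` for all `w` and `J`.
[cite: NesterenkoPhilippon2001, Ch. 11 §2.1 (polynomial representations of morphisms)] -/
def IsThetaMorphic (Φ : (β ⊕ (γ ⊕ δ) → ℂ) → (β ⊕ (γ ⊕ δ) → ℂ)) : Prop :=
  ∀ w₀ : β ⊕ (γ ⊕ δ) → ℂ, ∃ (d : ℕ)
    (A : Option β × ThetaIdx γ δ → MvPolynomial (Option β × ThetaIdx γ δ) ℂ)
    (u : (β ⊕ (γ ⊕ δ) → ℂ) → ℂ),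
    (∀ J, (A J).IsHomogeneous d) ∧ u w₀ ≠ 0 ∧
      ∀ w J, thetaEval L κM (A J) w = u w * theta L κM' J (Φ w)

omit [Fintype β] [Fintype δ] in
/-- The identity is `Θ`-morphic. [folklore] -/
theorem IsThetaMorphic.id : IsThetaMorphic L κM κM (fun w : β ⊕ (γ ⊕ δ) → ℂ => w) := fun _ =>
  ⟨1, fun J => X J, fun _ => 1, fun J => isHomogeneous_X ℂ J, one_ne_zero, fun w J => by simp⟩

omit [Fintype β] [Fintype δ] in
/-- **Composites of `Θ`-morphic maps are `Θ`-morphic** (substitute the forms of the first map into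
those of the second). [folklore] -/
theorem IsThetaMorphic.comp {Φ Ψ : (β ⊕ (γ ⊕ δ) → ℂ) → (β ⊕ (γ ⊕ δ) → ℂ)}
    (hΨ : IsThetaMorphic L κM' κM'' Ψ) (hΦ : IsThetaMorphic L κM κM' Φ) :
    IsThetaMorphic L κM κM'' (fun w => Ψ (Φ w)) := by
  intro w₀
  obtain ⟨d₁, A, u, hA, hu, hAeval⟩ := hΦ w₀
  obtain ⟨d₂, B, v, hB, hv, hBeval⟩ := hΨ (Φ w₀)
  refine ⟨d₁ * d₂, fun J => bind₁ A (B J), fun w => u w ^ d₂ * v (Φ w), fun J => ?_,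
    mul_ne_zero (pow_ne_zero _ hu) hv, fun w J => ?_⟩
  · rw [← aeval_eq_bind₁]
    exact (hB J).aeval _ hA
  · unfold thetaEval
    rw [eval_bind₁]
    have h : (fun I => eval (fun J' => theta L κM J' w) (A I)) =
        u w • fun I => theta L κM' I (Φ w) := by
      funext I
      exact hAeval w I
    rw [h, eval_smul_of_isHomogeneous (hB J)]
    change u w ^ d₂ * thetaEval L κM' (B J) (Φ w) = _
    rw [hBeval (Φ w) J, mul_assoc]

omit [Fintype β] [Fintype δ] in
/-- Congruence: `Θ`-morphic is a property of the map as a function. [folklore] -/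
theorem IsThetaMorphic.congr {Φ Ψ : (β ⊕ (γ ⊕ δ) → ℂ) → (β ⊕ (γ ⊕ δ) → ℂ)}
    (hΦ : IsThetaMorphic L κM κM' Φ) (h : ∀ w, Φ w = Ψ w) : IsThetaMorphic L κM κM' Ψ := by
  have : Φ = Ψ := funext h
  subst this
  exact hΦ

/-! ### Definable sets and their preimages -/

/-- **`Θ`-definable subsets of `Lie M_κ`**: common zero sets of sets of forms (read through
`thetaEval`). [folklore] -/
def ThetaDefinable (X : Set (β ⊕ (γ ⊕ δ) → ℂ)) : Prop :=
  ∃ Ps : Set (MvPolynomial (Option β × ThetaIdx γ δ) ℂ),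
    (∀ P ∈ Ps, ∃ d, P.IsHomogeneous d) ∧ X = {w | ∀ P ∈ Ps, thetaEval L κM P w = 0}

omit [Fintype β] [Fintype δ] in
/-- Intersections of definable sets are definable. [folklore] -/
theorem ThetaDefinable.inter {X Y : Set (β ⊕ (γ ⊕ δ) → ℂ)} (hX : ThetaDefinable L κM X)
    (hY : ThetaDefinable L κM Y) : ThetaDefinable L κM (X ∩ Y) := by
  obtain ⟨Ps, hPs, rfl⟩ := hX
  obtain ⟨Qs, hQs, rfl⟩ := hY
  refine ⟨Ps ∪ Qs, fun P hP => hP.elim (hPs P) (hQs P), Set.ext fun w => ?_⟩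
  simp only [Set.mem_inter_iff, Set.mem_setOf_eq, Set.mem_union]
  exact ⟨fun h P hP => hP.elim (h.1 P) (h.2 P), fun h => ⟨fun P hP => h P (Or.inl hP), fun P hP => h P (Or.inr hP)⟩⟩

omit [Fintype β] [Fintype δ] in
/-- Indexed intersections of definable sets are definable. [folklore] -/
theorem ThetaDefinable.iInter {ι : Sort*} {X : ι → Set (β ⊕ (γ ⊕ δ) → ℂ)}
    (hX : ∀ i, ThetaDefinable L κM (X i)) : ThetaDefinable L κM (⋂ i, X i) := by
  choose Ps hPs hX using hX
  refine ⟨⋃ i, Ps i, fun P hP => ?_, Set.ext fun w => ?_⟩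
  · obtain ⟨i, hi⟩ := Set.mem_iUnion.mp hP
    exact hPs i P hi
  · simp only [Set.mem_iInter, Set.mem_setOf_eq, Set.mem_iUnion]
    constructor
    · rintro h P ⟨i, hi⟩
      have := h i
      rw [hX i] at this
      exact this P hi
    · intro h i
      rw [hX i]
      exact fun P hP => h P ⟨i, hP⟩

omit [Fintype β] [Fintype δ] in
/-- The whole space is definable. [folklore] -/
theorem ThetaDefinable.univ : ThetaDefinable L κM (Set.univ : Set (β ⊕ (γ ⊕ δ) → ℂ)) :=
  ⟨∅, fun _ h => absurd h (Set.notMem_empty _), by simp⟩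

omit [Fintype β] [Fintype δ] in
/-- The zero set of one form is definable. [folklore] -/
theorem thetaDefinable_zeroSet {P : MvPolynomial (Option β × ThetaIdx γ δ) ℂ} {d : ℕ}
    (hP : P.IsHomogeneous d) : ThetaDefinable L κM {w | thetaEval L κM P w = 0} :=
  ⟨{P}, fun Q hQ => ⟨d, by rw [Set.mem_singleton_iff.mp hQ]; exact hP⟩, by simp⟩

omit [Fintype β] [Fintype δ] in
/-- **Preimages of definable sets under `Θ`-morphic maps are definable**: pull the defining forms
back through every local polynomial representation of the map. [folklore] -/
theorem ThetaDefinable.preimage {Φ : (β ⊕ (γ ⊕ δ) → ℂ) → (β ⊕ (γ ⊕ δ) → ℂ)}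
    (hΦ : IsThetaMorphic L κM κM' Φ) {X : Set (β ⊕ (γ ⊕ δ) → ℂ)} (hX : ThetaDefinable L κM' X) :
    ThetaDefinable L κM (Φ ⁻¹' X) := by
  obtain ⟨Ps, hPs, rfl⟩ := hX
  -- all polynomial representations of `Φ`
  let Rs : Set (ℕ × (Option β × ThetaIdx γ δ → MvPolynomial (Option β × ThetaIdx γ δ) ℂ)) :=
    {p | (∀ J, (p.2 J).IsHomogeneous p.1) ∧ ∃ u : (β ⊕ (γ ⊕ δ) → ℂ) → ℂ,
      ∀ w J, thetaEval L κM (p.2 J) w = u w * theta L κM' J (Φ w)}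
  refine ⟨{Q | ∃ p ∈ Rs, ∃ P ∈ Ps, Q = bind₁ p.2 P}, ?_, Set.ext fun w => ?_⟩
  · rintro Q ⟨p, hp, P, hP, rfl⟩
    obtain ⟨d, hd⟩ := hPs P hP
    refine ⟨p.1 * d, ?_⟩
    rw [← aeval_eq_bind₁]
    exact hd.aeval _ hp.1
  · simp only [Set.mem_preimage, Set.mem_setOf_eq]
    have key : ∀ p ∈ Rs, ∀ P ∈ Ps, ∃ (u : (β ⊕ (γ ⊕ δ) → ℂ) → ℂ) (d : ℕ),
        (∀ w' J, thetaEval L κM (p.2 J) w' = u w' * theta L κM' J (Φ w')) ∧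
        thetaEval L κM (bind₁ p.2 P) w = u w ^ d * thetaEval L κM' P (Φ w) := by
      rintro p ⟨hp, u, hu⟩ P hP
      obtain ⟨d, hd⟩ := hPs P hP
      refine ⟨u, d, hu, ?_⟩
      unfold thetaEval
      rw [eval_bind₁]
      have h : (fun I => eval (fun J' => theta L κM J' w) (p.2 I)) =
          u w • fun I => theta L κM' I (Φ w) := by
        funext I
        exact hu w I
      rw [h, eval_smul_of_isHomogeneous hd]
    constructor
    · intro h
      rintro Q ⟨p, hp, P, hP, rfl⟩
      obtain ⟨u, d, -, hval⟩ := key p hp P hP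
      rw [hval, h P hP, mul_zero]
    · intro h P hP
      obtain ⟨d, A, u, hA, hu, hAeval⟩ := hΦ w
      have hp : ((d, A) : ℕ × _) ∈ Rs := ⟨hA, u, hAeval⟩
      obtain ⟨u', d', hu', hval⟩ := key (d, A) hp P hP
      have hQ := h (bind₁ A P) ⟨(d, A), hp, P, hP, rfl⟩
      rw [hval] at hQ
      -- `u' w ≠ 0`: compare the two representations at a non-vanishing theta coordinate
      obtain ⟨J, hJ⟩ := exists_theta_ne_zero L κM' (Φ w)
      have h1 := hAeval w J
      have h2 := hu' w J
      simp only at h2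
      rw [h1] at h2
      have hu'ne : u' w ≠ 0 := by
        intro h0
        rw [h0, zero_mul] at h2
        exact (mul_ne_zero hu hJ) h2
      exact (mul_eq_zero.mp hQ).resolve_left (pow_ne_zero _ hu'ne)

/-! ### Translations are `Θ`-morphic -/

omit [Fintype β] [Fintype δ] in
/-- **Translations `w ↦ w + u` are `Θ`-morphic** (the composed addition law through an auxiliary
point, good at any prescribed point). [cite: NesterenkoPhilippon2001, Ch. 11 §2.1 (84)] -/
theorem isThetaMorphic_add_const (u : β ⊕ (γ ⊕ δ) → ℂ) :
    IsThetaMorphic L κM κM (fun w => w + u) := by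
  intro w₀
  obtain ⟨s, hs⟩ := exists_lawUnit_ne_zero (β := β) (δ := δ) L w₀ u
  exact ⟨4, fun J => lawPoly L κM s u J, fun w => lawUnit (β := β) (δ := δ) L s w u,
    fun J => lawPoly_isHomogeneous L κM s u J, hs, fun w J => thetaEval_lawPoly L κM s u J w⟩

/-! ### The sign change of one `E`-coordinate -/

/-- `κ` with the sign of column `b₀` changed: the datum of the group `M_{κ'}` isomorphic to `M_κ`
under `z'_{b₀} ↦ -z'_{b₀}`. [folklore] -/
def flipKappa (b₀ : γ) : δ → γ → Kbar := fun e b => if b = b₀ then -κM e b else κM e b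

/-- The sign change `z'_{b₀} ↦ -z'_{b₀}` on `Lie M_κ,ℂ` (all other coordinates fixed). [folklore] -/
def flipMap (b₀ : γ) (w : β ⊕ (γ ⊕ δ) → ℂ) : β ⊕ (γ ⊕ δ) → ℂ :=
  coords (fun j => w (iy j)) (fun b => if b = b₀ then -w (iz b) else w (iz b)) fun e => w (is e)

omit [Fintype β] [Fintype γ] [Fintype δ] in
/-- The flipped coordinate. [folklore] -/
@[simp] theorem flipMap_iz_self (b₀ : γ) (w : β ⊕ (γ ⊕ δ) → ℂ) :
    flipMap b₀ w (iz b₀) = -w (iz b₀) := by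
  simp [flipMap]

omit [Fintype β] [Fintype γ] [Fintype δ] in
/-- The other `E`-coordinates are fixed. [folklore] -/
theorem flipMap_iz_of_ne {b₀ b : γ} (h : b ≠ b₀) (w : β ⊕ (γ ⊕ δ) → ℂ) :
    flipMap b₀ w (iz b) = w (iz b) := by
  simp [flipMap, h]

omit [Fintype β] [Fintype γ] [Fintype δ] in
/-- The torus coordinates are fixed. [folklore] -/
@[simp] theorem flipMap_iy (b₀ : γ) (w : β ⊕ (γ ⊕ δ) → ℂ) (j : β) : flipMap b₀ w (iy j) = w (iy j) := by
  simp [flipMap]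

omit [Fintype β] [Fintype γ] [Fintype δ] in
/-- The fibre coordinates are fixed. [folklore] -/
@[simp] theorem flipMap_is (b₀ : γ) (w : β ⊕ (γ ⊕ δ) → ℂ) (e : δ) : flipMap b₀ w (is e) = w (is e) := by
  simp [flipMap]

omit [Fintype β] [Fintype γ] [Fintype δ] in
/-- The flip is an involution. [folklore] -/
theorem flipMap_flipMap (b₀ : γ) (w : β ⊕ (γ ⊕ δ) → ℂ) : flipMap b₀ (flipMap b₀ w) = w := by
  funext k
  rcases k with j | b | e
  · exact flipMap_iy b₀ (flipMap b₀ w) j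
  · by_cases hb : b = b₀
    · subst hb
      change flipMap b (flipMap b w) (iz b) = w (iz b)
      rw [flipMap_iz_self, flipMap_iz_self, neg_neg]
    · change flipMap b₀ (flipMap b₀ w) (iz b) = w (iz b)
      rw [flipMap_iz_of_ne hb, flipMap_iz_of_ne hb]
  · exact flipMap_is b₀ (flipMap b₀ w) e

omit [Fintype β] [Fintype γ] [Fintype δ] [DecidableEq γ] in
/-- `flipKappa` is an involution. [folklore] -/
theorem flipKappa_flipKappa (b₀ : γ) [DecidableEq γ] : flipKappa (flipKappa κM b₀) b₀ = κM := by
  funext e b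
  by_cases hb : b = b₀ <;> simp [flipKappa, hb]

omit [Fintype β] [Fintype γ] [Fintype δ] in
/-- The value of a block of the flipped point. [folklore] -/
theorem univExtP_flipMap (b₀ : γ) (M : γ → Fin 3) (w : β ⊕ (γ ⊕ δ) → ℂ) (b : γ) :
    L.univExtP (M b) (flipMap b₀ w (iz b)) =
      (if b = b₀ then blockSign (M b₀) else 1) * L.univExtP (M b) (w (iz b)) := by
  by_cases hb : b = b₀
  · subst hb; rw [flipMap_iz_self, L.univExtP_neg]; simp
  · rw [flipMap_iz_of_ne hb]; simp [hb]

omit [Fintype β] [Fintype γ] [Fintype δ] in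
/-- The value of a companion of the flipped point. [folklore] -/
theorem univExtZ_flipMap (b₀ : γ) (M : γ → Fin 3) (w : β ⊕ (γ ⊕ δ) → ℂ) (b : γ) :
    L.univExtZ (M b) (flipMap b₀ w (iz b)) =
      (if b = b₀ then -blockSign (M b₀) else 1) * L.univExtZ (M b) (w (iz b)) := by
  by_cases hb : b = b₀
  · subst hb; rw [flipMap_iz_self, L.univExtZ_neg]; simp
  · rw [flipMap_iz_of_ne hb]; simp [hb]

omit [Fintype β] [Fintype δ] in
/-- `∏_b P_{M b}` of the flipped point picks up the sign `ε_{M b₀}`. [folklore] -/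
theorem thetaPnone_flipMap (b₀ : γ) (M : γ → Fin 3) (w : β ⊕ (γ ⊕ δ) → ℂ) :
    thetaPnone (β := β) (δ := δ) L M (flipMap b₀ w) = blockSign (M b₀) * thetaPnone L M w := by
  unfold thetaPnone
  simp_rw [univExtP_flipMap L b₀ M w]
  rw [Finset.prod_mul_distrib, Finset.prod_ite_eq' Finset.univ b₀, if_pos (Finset.mem_univ _)]

omit [Fintype β] [Fintype δ] in
/-- A product over the other blocks of the flipped point. [folklore] -/
theorem prod_erase_univExtP_flipMap (b₀ : γ) (M : γ → Fin 3) (w : β ⊕ (γ ⊕ δ) → ℂ) (b : γ) :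
    ∏ b' ∈ Finset.univ.erase b, L.univExtP (M b') (flipMap b₀ w (iz b')) =
      (if b = b₀ then 1 else blockSign (M b₀)) *
        ∏ b' ∈ Finset.univ.erase b, L.univExtP (M b') (w (iz b')) := by
  simp_rw [univExtP_flipMap L b₀ M w]
  rw [Finset.prod_mul_distrib]
  congr 1
  by_cases hb : b = b₀
  · subst hb
    rw [if_pos rfl]
    exact Finset.prod_eq_one fun b' hb' => by rw [if_neg (Finset.ne_of_mem_erase hb')]
  · rw [if_neg hb, Finset.prod_ite_eq' (Finset.univ.erase b) b₀, if_pos (by simp [Ne.symm hb])]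

omit [Fintype β] [Fintype δ] in
/-- **The fibre sections of the flipped point, for the flipped `κ`**: the sign `ε_{M b₀}` again
(the sign change of `κ_{·b₀}` compensates the parity `Z(-z) = -ε Z(z)` of the companions). [folklore] -/
theorem thetaPsome_flipMap (b₀ : γ) (M : γ → Fin 3) (e : δ) (w : β ⊕ (γ ⊕ δ) → ℂ) :
    thetaPsome (β := β) L (flipKappa κM b₀) M e (flipMap b₀ w) = blockSign (M b₀) * thetaPsome L κM M e w := by
  have hterm : ∀ b, ((flipKappa κM b₀ e b : Kbar) : ℂ) *
      (L.univExtZ (M b) (flipMap b₀ w (iz b)) *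
        ∏ b' ∈ Finset.univ.erase b, L.univExtP (M b') (flipMap b₀ w (iz b'))) =
      blockSign (M b₀) * ((κM e b : ℂ) * (L.univExtZ (M b) (w (iz b)) *
        ∏ b' ∈ Finset.univ.erase b, L.univExtP (M b') (w (iz b')))) := by
    intro b
    rw [univExtZ_flipMap L b₀ M w, prod_erase_univExtP_flipMap L b₀ M w]
    by_cases hb : b = b₀
    · subst hb; simp [flipKappa]; ring
    · simp [flipKappa, hb]; ring
  unfold thetaPsome
  rw [thetaPnone_flipMap, flipMap_is, Finset.sum_congr rfl fun b _ => hterm b, ← Finset.mul_sum]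
  ring

omit [Fintype β] [Fintype δ] in
/-- **`Θ_{κ',J}(flip w) = ε_{M b₀} Θ_{κ,J}(w)`** for `J = (a, (M, o))`. [folklore] -/
theorem theta_flipMap (b₀ : γ) (J : Option β × ThetaIdx γ δ) (w : β ⊕ (γ ⊕ δ) → ℂ) :
    theta L (flipKappa κM b₀) J (flipMap b₀ w) = blockSign (J.2.1 b₀) * theta L κM J w := by
  obtain ⟨a, M, o⟩ := J
  have hT : thetaT (γ := γ) (δ := δ) a (flipMap b₀ w) = thetaT a w := by
    cases a <;> simp [thetaT]
  cases o with
  | none =>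
    simp only [theta, thetaP_none, hT, thetaPnone_flipMap]
    ring
  | some e =>
    simp only [theta, thetaP_some, hT, thetaPsome_flipMap]
    ring

omit [Fintype β] [Fintype δ] in
/-- **The sign change `z'_{b₀} ↦ -z'_{b₀}` is `Θ`-morphic** `M_κ → M_{κ'}`, `κ' = flipKappa κ b₀`
(globally, by the linear forms `ε_J X_J`). [folklore] -/
theorem isThetaMorphic_flip (b₀ : γ) :
    IsThetaMorphic L κM (flipKappa κM b₀)
      (flipMap b₀ : (β ⊕ (γ ⊕ δ) → ℂ) → (β ⊕ (γ ⊕ δ) → ℂ)) := fun _ =>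
  ⟨1, fun J => C (blockSign (J.2.1 b₀)) * X J, fun _ => 1,
    fun J => by simpa using (isHomogeneous_X ℂ J).C_mul (blockSign (J.2.1 b₀)), one_ne_zero,
    fun w J => by
      rw [theta_flipMap, one_mul]
      simp [thetaEval]⟩

omit [Fintype β] [Fintype δ] in
/-- The sign change is `Θ`-morphic in the other direction as well (it is an involution and
`flipKappa` is an involution). [folklore] -/
theorem isThetaMorphic_flip_symm (b₀ : γ) :
    IsThetaMorphic L (flipKappa κM b₀) κM
      (flipMap b₀ : (β ⊕ (γ ⊕ δ) → ℂ) → (β ⊕ (γ ⊕ δ) → ℂ)) := by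
  have h := isThetaMorphic_flip (β := β) L (flipKappa κM b₀) b₀
  rwa [flipKappa_flipKappa] at h

end Std

end GaGmE

end Literature.NumberTheory.Transcendental

end
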